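import Summits.AtomisticToContinuum.HydrodynamicLimit.Theorems.AntiMazurCoboundariesCellForecastPressureDecayEnskogObjects
import Literature.MathematicalPhysics.StatisticalMechanics.HardCoreCanonical
import Mathlib.MeasureTheory.Measure.Lebesgue.VolumeOfBalls
import Mathlib.Probability.ConditionalProbability
import HarnessLib

/-!
# S2b(A) · the Ruelle-type bound for the canonical cell (first file of stub `stub_contactLayerBounds`,
# crux line `enskog-compensator-martingale`, crux `CellForecastPressureDecay`, stmt-AtomisticToContinuum-13915)

The uniform hard-core position law `posLaw σ L n` of `n ≤ 2L³` sphere centres (closed hard core `σ ≤ 3/16`)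
in the cube `[0,L]³`, `L ≥ 1`, is dominated on few-label events by the law of INDEPENDENT uniform points:
for an event `E` involving only the positions of the labels in `B`,
`posLaw σ L n E ≤ 2^{#B} · ν^{⊗n}(E)`, `ν` the uniform probability law on the cube
(`posLaw_le_two_pow_mul_pi`, registered sub-goal `stub_contactLayerBounds_ruelle`). This is the CUBE
instance of the tree's generic canonical hard-core gas of independent points
(`Literature/MathematicalPhysics/StatisticalMechanics/HardCoreCanonical`; torus templates
`KineticTheory/HardSphereCanonicalPairBound`, `HardSphereCanonicalClusterBound`):
* § 1 (generic, any one-point law `ν` and symmetric measurable overlap relation `O`): dropping the hard-core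
  constraints of the labels `B` costs the ratio `Ξ(univ ∖ B)/Ξ(univ)` (independence of disjoint blocks,
  `pi_hardCore_inter_le_hcProb_mul`), which the insertion bound `Ξ(W)(1 − #W p) ≤ Ξ(W ∪ {m})`
  (`hcProb_insert_ge`) pins below `2^{#B}` as soon as one excluded ball has mass `p` with `n p ≤ 1/2`
  (`hcProb_univ_sdiff_le_two_pow_mul`, `cond_pi_hardCore_le_two_pow_mul`);
* § 2–3 (the cube): `ν^{⊗n}` is Lebesgue measure conditioned on the box `([0,L]³)ⁿ` (`pi_cond_cellCube`),
  `posLaw σ L n = ν^{⊗n}( · | hard core)` (`posLaw_eq_cond_pi`, conditioning twice), and one ball of radius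
  `σ` has `ν`-mass `≤ (4π/3)σ³/L³`, so `n p ≤ (8π/3)σ³ ≤ 1/2` for `σ ≤ 3/16`, `n ≤ 2L³`.

References: D. Ruelle, *Statistical Mechanics: Rigorous Results* (1969), §4.2 (bounds on the canonical
correlation functions of a hard-core gas by insertion ratios); E. Pulvirenti, D. Tsagkarogiannis,
Comm. Math. Phys. 316 (2012) 289–306, §3.
-/

noncomputable section

open MeasureTheory ProbabilityTheory Set Filter
open scoped ENNReal BigOperators InnerProductSpace
open Literature.Analysis.FluidPDE Literature.MathematicalPhysics.KineticTheory
open Literature.MathematicalPhysics.StatisticalMechanics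
open Summit.AtomisticToContinuum.HydrodynamicLimit.Theorems.CellForecastPressureDecay
  (cellCube measurableSet_cellCube volume_cellCube)

namespace Summit.AtomisticToContinuum.HydrodynamicLimit.Theorems.EnskogCompensator


/-! ## § 1 Generic Ruelle-type bound for the canonical hard-core gas of independent points -/

section Generic

variable {X : Type*} [MeasurableSpace X]

omit [MeasurableSpace X] in
/-- The indicator of an event that only involves the labels in `B` depends only on `B`. [folklore] -/
theorem dependsOn_indicator_one_of_mem_iff {n : ℕ} {B : Finset (Fin n)} {E : Set (Fin n → X)}
    (hdep : ∀ x y : Fin n → X, (∀ b ∈ B, x b = y b) → (x ∈ E ↔ y ∈ E)) :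
    DependsOn (fun x : Fin n → X => E.indicator (1 : (Fin n → X) → ℝ) x) (B : Set (Fin n)) := by
  intro x y hxy
  change E.indicator (1 : (Fin n → X) → ℝ) x = E.indicator (1 : (Fin n → X) → ℝ) y
  have hiff := hdep x y fun b hb => hxy b hb
  by_cases hx : x ∈ E
  · rw [Set.indicator_of_mem hx, Set.indicator_of_mem (hiff.1 hx)]; rfl
  · rw [Set.indicator_of_notMem hx, Set.indicator_of_notMem (fun hy => hx (hiff.2 hy))]

/-- **Dropping constraints**: for an event `E` involving only the labels in `B`,
`ν^{⊗}(hardCore(univ) ∩ E) ≤ Ξ(univ ∖ B) · ν^{⊗}(E)` (independence of disjoint blocks of labels).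
[cite: Ruelle1969, §4.2] -/
theorem pi_hardCore_inter_le_hcProb_mul (ν : Measure X) [IsProbabilityMeasure ν] {O : X → X → Prop}
    (hO : MeasurableSet {p : X × X | O p.1 p.2}) {n : ℕ} (B : Finset (Fin n)) {E : Set (Fin n → X)}
    (hE : MeasurableSet E) (hdep : ∀ x y : Fin n → X, (∀ b ∈ B, x b = y b) → (x ∈ E ↔ y ∈ E)) :
    Measure.pi (fun _ : Fin n => ν) (hardCoreSet O (Finset.univ : Finset (Fin n)) ∩ E) ≤
      ENNReal.ofReal (hcProb O ν ((Finset.univ : Finset (Fin n)) \ B)) *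
        Measure.pi (fun _ : Fin n => ν) E := by
  classical
  set W : Finset (Fin n) := (Finset.univ : Finset (Fin n)) \ B with hW
  set P : Measure (Fin n → X) := Measure.pi fun _ : Fin n => ν with hP
  have hHC : MeasurableSet (hardCoreSet O W : Set (Fin n → X)) := measurableSet_hardCoreSet hO W
  have hsub : hardCoreSet O (Finset.univ : Finset (Fin n)) ∩ E ⊆ hardCoreSet O W ∩ E :=
    Set.inter_subset_inter_left _ fun x hx a _ b _ hab =>
      hx a (Finset.mem_univ a) b (Finset.mem_univ b) hab
  refine (measure_mono hsub).trans ?_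
  have hdisj : Disjoint W B := Finset.sdiff_disjoint
  have hF : DependsOn (fun x : Fin n → X =>
      (hardCoreSet O W : Set (Fin n → X)).indicator (1 : (Fin n → X) → ℝ) x) (W : Set (Fin n)) := by
    refine dependsOn_indicator_one_of_mem_iff fun x y hxy => ?_
    simp only [hardCoreSet, Set.mem_setOf_eq]
    constructor
    · intro h a ha b hb hab; rw [← hxy a ha, ← hxy b hb]; exact h a ha b hb hab
    · intro h a ha b hb hab; rw [hxy a ha, hxy b hb]; exact h a ha b hb hab
  have hG : DependsOn (fun x : Fin n → X => E.indicator (1 : (Fin n → X) → ℝ) x) (B : Set (Fin n)) :=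
    dependsOn_indicator_one_of_mem_iff hdep
  have hFm : Measurable fun x : Fin n → X =>
      (hardCoreSet O W : Set (Fin n → X)).indicator (1 : (Fin n → X) → ℝ) x :=
    measurable_one.indicator hHC
  have hGm : Measurable fun x : Fin n → X => E.indicator (1 : (Fin n → X) → ℝ) x :=
    measurable_one.indicator hE
  have hprod := integral_mul_eq_of_dependsOn ν hdisj hFm hGm hF hG
  have hinter : (hardCoreSet O W ∩ E).indicator (1 : (Fin n → X) → ℝ) =
      fun x => (hardCoreSet O W : Set (Fin n → X)).indicator 1 x * E.indicator 1 x := by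
    rw [Set.inter_indicator_one]
    rfl
  have h1 : P.real (hardCoreSet O W ∩ E) = hcProb O ν W * P.real E := by
    rw [← integral_indicator_one (hHC.inter hE), hinter, hP, hprod, integral_indicator_one hHC,
      integral_indicator_one hE, hcProb]
  haveI : IsFiniteMeasure P := by rw [hP]; infer_instance
  rw [← ENNReal.ofReal_toReal (measure_ne_top P _), ← measureReal_def, h1,
    ENNReal.ofReal_mul (hcProb_nonneg ν W), measureReal_def, ENNReal.ofReal_toReal (measure_ne_top _ _)]

/-- **Iterated insertion bound**: if one ball has mass `≤ p` and `n p ≤ 1/2`, then removing the labels `B`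
from the hard core costs at most a factor `2^{#B}`: `Ξ(univ ∖ B) ≤ 2^{#B} Ξ(univ)`. [cite: Ruelle1969, §4.2] -/
theorem hcProb_univ_sdiff_le_two_pow_mul (ν : Measure X) [IsProbabilityMeasure ν] {O : X → X → Prop}
    (hO : MeasurableSet {p : X × X | O p.1 p.2}) (hOs : ∀ a b, O a b → O b a) {p : ℝ} (hp0 : 0 ≤ p)
    (hp : ∀ z, ν {y | O z y} ≤ ENNReal.ofReal p) {n : ℕ} (hnp : (n : ℝ) * p ≤ 1 / 2)
    (B : Finset (Fin n)) :
    hcProb O ν ((Finset.univ : Finset (Fin n)) \ B) ≤ 2 ^ B.card * hcProb O ν (Finset.univ : Finset (Fin n)) := by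
  induction B using Finset.induction_on with
  | empty => simp
  | @insert b B hb ih =>
    set W : Finset (Fin n) := (Finset.univ : Finset (Fin n)) \ insert b B with hW
    have hbW : b ∉ W := by simp [hW]
    have hins : insert b W = (Finset.univ : Finset (Fin n)) \ B := by
      ext a
      simp only [hW, Finset.mem_insert, Finset.mem_sdiff, Finset.mem_univ, true_and, not_or]
      constructor
      · rintro (rfl | ⟨-, haB⟩)
        exacts [hb, haB]
      · intro haB
        by_cases hab : a = b
        exacts [Or.inl hab, Or.inr ⟨hab, haB⟩]
    have hge := hcProb_insert_ge ν hO hOs hp0 hp hbW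
    rw [hins] at hge
    have hWn : (W.card : ℝ) ≤ n := by exact_mod_cast (Finset.card_le_univ W).trans_eq (Fintype.card_fin n)
    have hWc : (W.card : ℝ) * p ≤ 1 / 2 := (mul_le_mul_of_nonneg_right hWn hp0).trans hnp
    have h0 : 0 ≤ hcProb O ν W := hcProb_nonneg ν W
    rw [Finset.card_insert_of_notMem hb, pow_succ]
    calc hcProb O ν W ≤ hcProb O ν W * (2 * (1 - W.card * p)) :=
          le_mul_of_one_le_right h0 (by linarith)
      _ = 2 * (hcProb O ν W * (1 - W.card * p)) := by ring
      _ ≤ 2 * hcProb O ν ((Finset.univ : Finset (Fin n)) \ B) := by linarith [hge]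
      _ ≤ 2 * (2 ^ B.card * hcProb O ν (Finset.univ : Finset (Fin n))) := by linarith [ih]
      _ = 2 ^ B.card * 2 * hcProb O ν (Finset.univ : Finset (Fin n)) := by ring

/-- **Ruelle-type bound for the canonical hard-core gas of independent points**: if one ball has mass
`≤ p` with `n p ≤ 1/2`, an event involving only the labels in `B` has probability under
`ν^{⊗n}( · | hard core)` at most `2^{#B}` times its `ν^{⊗n}`-probability (and the conditional law is `0`
if the hard core is `ν^{⊗n}`-null). [cite: Ruelle1969, §4.2] -/
theorem cond_pi_hardCore_le_two_pow_mul (ν : Measure X) [IsProbabilityMeasure ν] {O : X → X → Prop}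
    (hO : MeasurableSet {p : X × X | O p.1 p.2}) (hOs : ∀ a b, O a b → O b a) {p : ℝ} (hp0 : 0 ≤ p)
    (hp : ∀ z, ν {y | O z y} ≤ ENNReal.ofReal p) {n : ℕ} (hnp : (n : ℝ) * p ≤ 1 / 2)
    (B : Finset (Fin n)) {E : Set (Fin n → X)} (hE : MeasurableSet E)
    (hdep : ∀ x y : Fin n → X, (∀ b ∈ B, x b = y b) → (x ∈ E ↔ y ∈ E)) :
    (Measure.pi fun _ : Fin n => ν)[|hardCoreSet O (Finset.univ : Finset (Fin n))] E ≤
      2 ^ B.card * Measure.pi (fun _ : Fin n => ν) E := by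
  have hH : MeasurableSet (hardCoreSet O (Finset.univ : Finset (Fin n)) : Set (Fin n → X)) :=
    measurableSet_hardCoreSet hO _
  rw [cond_apply hH]
  rcases eq_or_ne (Measure.pi (fun _ : Fin n => ν) (hardCoreSet O (Finset.univ : Finset (Fin n)))) 0
    with h0 | h0
  · have : Measure.pi (fun _ : Fin n => ν) (hardCoreSet O (Finset.univ : Finset (Fin n)) ∩ E) = 0 :=
      measure_mono_null Set.inter_subset_left h0
    rw [this, mul_zero]
    exact bot_le
  · have htop : Measure.pi (fun _ : Fin n => ν) (hardCoreSet O (Finset.univ : Finset (Fin n))) ≠ ⊤ :=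
      measure_ne_top _ _
    have hPH : ENNReal.ofReal (hcProb O ν (Finset.univ : Finset (Fin n))) =
        Measure.pi (fun _ : Fin n => ν) (hardCoreSet O (Finset.univ : Finset (Fin n))) := by
      rw [hcProb, measureReal_def, ENNReal.ofReal_toReal htop]
    calc (Measure.pi (fun _ : Fin n => ν) (hardCoreSet O Finset.univ))⁻¹ *
          Measure.pi (fun _ : Fin n => ν) (hardCoreSet O Finset.univ ∩ E)
        ≤ (Measure.pi (fun _ : Fin n => ν) (hardCoreSet O Finset.univ))⁻¹ *
            (ENNReal.ofReal (hcProb O ν ((Finset.univ : Finset (Fin n)) \ B)) *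
              Measure.pi (fun _ : Fin n => ν) E) :=
          mul_le_mul' le_rfl (pi_hardCore_inter_le_hcProb_mul ν hO B hE hdep)
      _ ≤ (Measure.pi (fun _ : Fin n => ν) (hardCoreSet O Finset.univ))⁻¹ *
            (ENNReal.ofReal (2 ^ B.card * hcProb O ν (Finset.univ : Finset (Fin n))) *
              Measure.pi (fun _ : Fin n => ν) E) := by
          gcongr
          exact hcProb_univ_sdiff_le_two_pow_mul ν hO hOs hp0 hp hnp B
      _ = 2 ^ B.card * ((Measure.pi (fun _ : Fin n => ν) (hardCoreSet O Finset.univ))⁻¹ *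
            Measure.pi (fun _ : Fin n => ν) (hardCoreSet O Finset.univ)) *
              Measure.pi (fun _ : Fin n => ν) E := by
          rw [ENNReal.ofReal_mul (by positivity), ENNReal.ofReal_pow zero_le_two, ENNReal.ofReal_ofNat,
            hPH]
          ring
      _ = 2 ^ B.card * Measure.pi (fun _ : Fin n => ν) E := by
          rw [ENNReal.inv_mul_cancel h0 htop, mul_one]

end Generic

/-! ## § 2 The uniform law on the cube and its powers -/

/-- The uniform probability law `ν = vol( · ∩ [0,L]³)/L³` on the cube is a probability measure for
`L > 0`. [folklore] -/
theorem isProbabilityMeasure_cond_cellCube {L : ℝ} (hL : 0 < L) :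
    IsProbabilityMeasure (volume[|cellCube L]) := by
  refine cond_isProbabilityMeasure_of_finite ?_ ?_
  · rw [volume_cellCube]
    exact pow_ne_zero _ (ENNReal.ofReal_pos.2 hL).ne'
  · rw [volume_cellCube]
    exact ENNReal.pow_ne_top ENNReal.ofReal_ne_top

/-- `(vol [0,L]³)⁻¹ = L⁻³`. [folklore] -/
theorem inv_volume_cellCube {L : ℝ} (hL : 0 < L) :
    (volume (cellCube L))⁻¹ = ENNReal.ofReal ((L ^ 3)⁻¹) := by
  rw [volume_cellCube, ← ENNReal.ofReal_pow hL.le, ← ENNReal.ofReal_inv_of_pos (pow_pos hL 3)]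

/-- `ν(T) ≤ vol(T)/L³`. [folklore] -/
theorem cond_cellCube_le (L : ℝ) (T : Set V3) :
    volume[|cellCube L] T ≤ (volume (cellCube L))⁻¹ * volume T := by
  rw [cond_apply (measurableSet_cellCube L)]
  exact mul_le_mul' le_rfl (measure_mono Set.inter_subset_right)

/-- Translates cost nothing: `ν{y | y − z ∈ T} ≤ vol(T)/L³`. [folklore] -/
theorem cond_cellCube_preimage_sub_le (L : ℝ) (T : Set V3) (z : V3) :
    volume[|cellCube L] ((fun y : V3 => y - z) ⁻¹' T) ≤ (volume (cellCube L))⁻¹ * volume T := by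
  refine (cond_cellCube_le L _).trans_eq ?_
  have hfun : (fun y : V3 => y - z) = fun y => y + -z := funext fun y => sub_eq_add_neg y z
  rw [hfun, measure_preimage_add_right]

/-- One ball of radius `σ` has `ν`-mass `≤ (4π/3) σ³ / L³`. [folklore] -/
theorem cond_cellCube_ball_le {L σ : ℝ} (hL : 0 < L) (hσ : 0 ≤ σ) (z : V3) :
    volume[|cellCube L] {y : V3 | ‖z - y‖ < σ} ≤
      ENNReal.ofReal ((L ^ 3)⁻¹ * (σ ^ 3 * (Real.pi * 4 / 3))) := by
  have hball : {y : V3 | ‖z - y‖ < σ} = Metric.ball z σ := by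
    ext y
    simp [Metric.mem_ball, dist_eq_norm, norm_sub_rev]
  rw [hball]
  refine (cond_cellCube_le L _).trans_eq ?_
  rw [inv_volume_cellCube hL, EuclideanSpace.volume_ball_fin_three, ← ENNReal.ofReal_pow hσ,
    ← ENNReal.ofReal_mul (pow_nonneg hσ 3), ← ENNReal.ofReal_mul (inv_nonneg.2 (pow_nonneg hL.le 3))]

/-- **The `n`-th power of the uniform law on the cube is Lebesgue measure conditioned on the box
`([0,L]³)ⁿ`.** [folklore] -/
theorem pi_cond_cellCube (L : ℝ) (n : ℕ) :
    Measure.pi (fun _ : Fin n => volume[|cellCube L]) =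
      volume[|Set.pi Set.univ fun _ : Fin n => cellCube L] := by
  refine Measure.pi_eq fun s _ => ?_
  rw [cond_apply (MeasurableSet.univ_pi fun _ => measurableSet_cellCube L), ← Set.pi_inter_distrib,
    volume_pi_pi, volume_pi_pi, Finset.prod_const, Finset.card_univ, Fintype.card_fin, ENNReal.inv_pow]
  simp only [cond_apply (measurableSet_cellCube L)]
  rw [Finset.prod_mul_distrib, Finset.prod_const, Finset.card_univ, Fintype.card_fin]

/-! ## § 3 The position law as the conditioned power of the uniform law -/

/-- The admissible set is the box `([0,L]³)ⁿ` cut by the hard core `¬ (‖xᵢ − xⱼ‖ < σ)`. [folklore] -/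
theorem posAdmissible_eq_pi_inter_hardCore (σ L : ℝ) (n : ℕ) :
    posAdmissible σ L n = (Set.pi Set.univ fun _ : Fin n => cellCube L) ∩
      hardCoreSet (fun y y' : V3 => ‖y - y'‖ < σ) (Finset.univ : Finset (Fin n)) := by
  ext x
  simp only [mem_posAdmissible, hardCoreSet, cellCube, Set.mem_inter_iff, Set.mem_pi, Set.mem_univ,
    true_implies, Set.mem_setOf_eq, Finset.mem_univ, not_lt]
  exact and_comm

/-- The overlap relation `‖y − y'‖ < σ` is measurable. [folklore] -/
theorem measurableSet_overlap_lt (σ : ℝ) :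
    MeasurableSet {p : V3 × V3 | (fun y y' : V3 => ‖y - y'‖ < σ) p.1 p.2} :=
  measurableSet_lt (continuous_fst.sub continuous_snd).norm.measurable measurable_const

/-- `posLaw` is Lebesgue measure conditioned on the admissible set. [folklore] -/
theorem posLaw_eq_cond_volume (σ L : ℝ) (n : ℕ) : posLaw σ L n = volume[|posAdmissible σ L n] := rfl

/-- **`posLaw = ν^{⊗n}( · | hard core)`**: the uniform law on the admissible set is the `n`-th power of
the uniform law on the cube conditioned on the hard core. [folklore] -/
theorem posLaw_eq_cond_pi (σ L : ℝ) (n : ℕ) :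
    posLaw σ L n = (Measure.pi fun _ : Fin n => volume[|cellCube L])[|
      hardCoreSet (fun y y' : V3 => ‖y - y'‖ < σ) (Finset.univ : Finset (Fin n))] := by
  have hfin : volume (Set.pi Set.univ fun _ : Fin n => cellCube L) ≠ ⊤ := by
    rw [volume_pi_pi]
    exact ENNReal.prod_ne_top fun _ _ => by
      rw [volume_cellCube]; exact ENNReal.pow_ne_top ENNReal.ofReal_ne_top
  rw [pi_cond_cellCube L n, cond_cond_eq_cond_inter' (MeasurableSet.univ_pi fun _ => measurableSet_cellCube L)
    (measurableSet_hardCoreSet (measurableSet_overlap_lt σ) _) hfin, ← posAdmissible_eq_pi_inter_hardCore]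
  rfl

/-- **Ruelle-type bound for the cell**: for `0 < σ ≤ 3/16`, `L ≥ 1`, `n ≤ 2L³`, an event involving only the
positions of the labels in `B` has `posLaw`-probability at most `2^{#B}` times its probability for `n`
independent uniform points of the cube (one excluded ball has mass `p ≤ (4π/3)σ³/L³`, `n p ≤ 1/2`).
[cite: Ruelle1969, §4.2] -/
theorem posLaw_le_two_pow_mul_pi {σ L : ℝ} (hσ : 0 < σ) (hσ' : σ ≤ 3 / 16) (hL : 1 ≤ L) {n : ℕ}
    (hn : (n : ℝ) ≤ 2 * L ^ 3) (B : Finset (Fin n)) {E : Set (Fin n → V3)} (hE : MeasurableSet E)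
    (hdep : ∀ x y : Fin n → V3, (∀ b ∈ B, x b = y b) → (x ∈ E ↔ y ∈ E)) :
    posLaw σ L n E ≤ 2 ^ B.card * Measure.pi (fun _ : Fin n => volume[|cellCube L]) E := by
  have hL0 : 0 < L := one_pos.trans_le hL
  haveI := isProbabilityMeasure_cond_cellCube hL0
  rw [posLaw_eq_cond_pi]
  have hp0 : 0 ≤ (L ^ 3)⁻¹ * (σ ^ 3 * (Real.pi * 4 / 3)) := by positivity
  refine cond_pi_hardCore_le_two_pow_mul (volume[|cellCube L]) (measurableSet_overlap_lt σ)
    (fun a b h => by simpa [norm_sub_rev] using h) hp0 (fun z => cond_cellCube_ball_le hL0 hσ.le z) ?_ B hE hdep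
  -- `n p ≤ 2 (4π/3) σ³ ≤ 1/2`
  have hnL : (n : ℝ) * (L ^ 3)⁻¹ ≤ 2 := by
    rw [← div_eq_mul_inv, div_le_iff₀ (pow_pos hL0 3)]
    exact hn
  have hσ3 : σ ^ 3 ≤ (3 / 16) ^ 3 := pow_le_pow_left₀ hσ.le hσ' 3
  have hπ : Real.pi * 4 / 3 ≤ 16 / 3 := by linarith [Real.pi_le_four]
  calc (n : ℝ) * ((L ^ 3)⁻¹ * (σ ^ 3 * (Real.pi * 4 / 3)))
      = ((n : ℝ) * (L ^ 3)⁻¹) * σ ^ 3 * (Real.pi * 4 / 3) := by ring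
    _ ≤ 2 * (3 / 16) ^ 3 * (16 / 3) := by gcongr
    _ ≤ 1 / 2 := by norm_num

/-! ## § 4 The registered sub-goal -/

/-- **Registered sub-goal `stub_contactLayerBounds_ruelle`** (first half of stub `stub_contactLayerBounds` of
the line `enskog-compensator-martingale`): the Ruelle-type bound for the canonical cell — for
`0 < σ ≤ 3/16`, `L ≥ 1`, `n ≤ 2L³`, an event involving only the positions of the labels in `B` has
probability under the uniform hard-core position law `posLaw σ L n` at most `2^{#B}` times its probability
for `n` independent uniform points of the cube `[0,L]³`. [cite: Ruelle1969, §4.2] -/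
theorem stub_contactLayerBounds_ruelle : ∀ (σ L : ℝ), 0 < σ → σ ≤ 3 / 16 → 1 ≤ L → ∀ (n : ℕ), (n : ℝ) ≤ 2 * L ^ 3 →
    ∀ (B : Finset (Fin n)) (E : Set (Fin n → V3)), MeasurableSet E →
      (∀ x y : Fin n → V3, (∀ b ∈ B, x b = y b) → (x ∈ E ↔ y ∈ E)) →
        posLaw σ L n E ≤ 2 ^ B.card *
          Measure.pi (fun _ : Fin n => ProbabilityTheory.cond volume {y : V3 | ∀ k, y k ∈ Set.Icc (0 : ℝ) L}) E :=
  fun _ _ hσ hσ' hL _ hn B _ hE hdep => posLaw_le_two_pow_mul_pi hσ hσ' hL hn B hE hdep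

end Summit.AtomisticToContinuum.HydrodynamicLimit.Theorems.EnskogCompensator

end
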